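import Summits.CriticalPhenomena.PercolationContinuityZ3.Theorems.Transplant.SkelPhiFaceNumsRead
import HarnessLib

/-!
# N1 ({±1} node), (F) inner route, part R5b-viii (hp-8 g33): **TWO-SIDED BOUNDS FOR THE NESTED FLOOR READINGS** `(c·(A·T / n)) / D`
# appearing in the fine readings of run boxes (`fine_mem_Icc_of_runX_mem_Icc_signed`: `c₀·(A·(mod·a − vα·b′)/n)/D`, `c₁·(A·b′)/D`):
# `c·A·T − c·n − n·D < n·D·((c·(A·T/n))/D) ≤ c·A·T` (`0 ≤ c`, `0 < n`, `0 < D`), and the one-level version `c·t − D < D·((c·t)/D) ≤ c·t`.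
# With `c = A·κ` and `D = A²·mod` these turn the readings into `κ·T/(n·mod)` up to explicit slack (the per-centre arithmetic).
builds on p205010 (kernel theorem, internal audit signed; external expert review pending) — nothing in this file uses p205010; no claim about the open node.
Lane `prim-bschramm`, seat `prim-hp-8` (gen 33); helper file (`--supports stmt-CriticalPhenomena-4575 --as helper`).
* `Skelφ.mul_ediv_le_self'`, `lt_mul_ediv_add`, **`nested_ediv_upper`**, **`nested_ediv_lower`**.
[cite: Timar2007, Lemma 2.2, p. 3] [cite: MartineauTassion2017, §4.1]
-/

namespace Summit.CriticalPhenomena.PercolationContinuityZ3.Theorems.Transplant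

namespace Skelφ

/-- `D·(x/D) ≤ x` (`0 < D`). [folklore] -/
theorem mul_ediv_le_self' (x : ℤ) {D : ℤ} (hD : 0 < D) : D * (x / D) ≤ x := by
  have := Int.mul_ediv_add_emod x D
  have := Int.emod_nonneg x hD.ne'
  linarith

/-- `x < D·(x/D) + D` (`0 < D`). [folklore] -/
theorem lt_mul_ediv_add (x : ℤ) {D : ℤ} (hD : 0 < D) : x < D * (x / D) + D := by
  have := Int.mul_ediv_add_emod x D
  have := Int.emod_lt_of_pos x hD
  linarith

/-- **Upper bound of the nested reading**: `n·D·((c·(A·T/n))/D) ≤ c·A·T` for `0 ≤ c`, `0 < n`, `0 < D`. [folklore] -/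
theorem nested_ediv_upper {c A T n D : ℤ} (hc : 0 ≤ c) (hn : 0 < n) (hD : 0 < D) : n * D * ((c * (A * T / n)) / D) ≤ c * A * T := by
  have h1 := mul_ediv_le_self' (c * (A * T / n)) hD
  have h2 := mul_ediv_le_self' (A * T) hn
  have h3 : n * (c * (A * T / n)) ≤ c * A * T := by nlinarith
  calc n * D * ((c * (A * T / n)) / D) = n * (D * ((c * (A * T / n)) / D)) := by ring
    _ ≤ n * (c * (A * T / n)) := mul_le_mul_of_nonneg_left h1 hn.le
    _ ≤ c * A * T := h3

/-- **Lower bound of the nested reading**: `c·A·T − c·n − n·D < n·D·((c·(A·T/n))/D)` for `0 ≤ c`, `0 < n`, `0 < D`. [folklore] -/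
theorem nested_ediv_lower {c A T n D : ℤ} (hc : 0 ≤ c) (hn : 0 < n) (hD : 0 < D) : c * A * T - c * n - n * D < n * D * ((c * (A * T / n)) / D) := by
  have h1 := lt_mul_ediv_add (c * (A * T / n)) hD
  have h2 := lt_mul_ediv_add (A * T) hn
  have h3 : c * A * T - c * n ≤ n * (c * (A * T / n)) := by nlinarith
  have h4 : n * (c * (A * T / n)) < n * (D * ((c * (A * T / n)) / D) + D) := mul_lt_mul_of_pos_left h1 hn
  nlinarith

/-! ## The readings in stride units: `n·mod·X ≈ κ₀·T`, `mod·X₁ ≈ κ₁·S` -/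

/-- **Axis-0 reading in stride units**: for `c₀ = A·κ₀`, `D = A²·mod` (`0 < A`, `0 ≤ κ₀`, `0 < mod`, `0 < n`), the reading `X = (c₀·(A·T/n))/D`
satisfies `κ₀·T − κ₀·n − n·mod ≤ n·mod·X ≤ κ₀·T`. [cite: MartineauTassion2017, §4.1] -/
theorem reading0_bounds {A κ₀ mod n c₀ D : ℤ} (hA : 0 < A) (hκ : 0 ≤ κ₀) (hmod : 0 < mod) (hn : 0 < n) (hc : c₀ = A * κ₀)
    (hD : D = A ^ 2 * mod) (T : ℤ) :
    κ₀ * T - κ₀ * n - n * mod ≤ n * mod * ((c₀ * (A * T / n)) / D) ∧ n * mod * ((c₀ * (A * T / n)) / D) ≤ κ₀ * T := by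
  have hc0 : 0 ≤ c₀ := by rw [hc]; positivity
  have hD0 : 0 < D := by rw [hD]; positivity
  have hA2 : 0 < A ^ 2 := by positivity
  set X := (c₀ * (A * T / n)) / D with hX
  have hup := nested_ediv_upper (A := A) (T := T) hc0 hn hD0
  have hlow := nested_ediv_lower (A := A) (T := T) hc0 hn hD0
  rw [← hX] at hup hlow
  rw [hc, hD] at hup hlow
  constructor
  · -- `A²·(κ₀T − κ₀n − n·mod) ≤ A²κ₀T − Aκ₀n − nA²mod < A²·(n·mod·X)`
    have h1 : A ^ 2 * (κ₀ * T - κ₀ * n - n * mod) ≤ A * κ₀ * A * T - A * κ₀ * n - n * (A ^ 2 * mod) := by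
      have : A * κ₀ * n ≤ A ^ 2 * (κ₀ * n) := by
        have hA1 : 1 ≤ A := hA
        have hkn : 0 ≤ κ₀ * n := mul_nonneg hκ hn.le
        have h3 : A * (κ₀ * n) ≤ A * A * (κ₀ * n) := by
          have := mul_le_mul_of_nonneg_right hA1 (mul_nonneg hA.le hkn)
          linarith
        nlinarith
      nlinarith
    have h2 : A ^ 2 * (κ₀ * T - κ₀ * n - n * mod) < A ^ 2 * (n * mod * X) := by
      have : n * (A ^ 2 * mod) * X = A ^ 2 * (n * mod * X) := by ring
      linarith
    exact (lt_of_mul_lt_mul_left h2 hA2.le).le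
  · have h2 : A ^ 2 * (n * mod * X) ≤ A ^ 2 * (κ₀ * T) := by
      have e1 : n * (A ^ 2 * mod) * X = A ^ 2 * (n * mod * X) := by ring
      have e2 : A * κ₀ * A * T = A ^ 2 * (κ₀ * T) := by ring
      linarith
    exact le_of_mul_le_mul_left h2 hA2

/-- **Axis-1 reading in stride units**: for `c₁ = A·κ₁`, `D = A²·mod`, the reading `X₁ = (c₁·(A·S))/D` satisfies
`κ₁·S − mod + 1 ≤ mod·X₁ ≤ κ₁·S`. [cite: MartineauTassion2017, §4.1] -/
theorem reading1_bounds {A κ₁ mod c₁ D : ℤ} (hA : 0 < A) (hmod : 0 < mod) (hc : c₁ = A * κ₁) (hD : D = A ^ 2 * mod) (S : ℤ) :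
    κ₁ * S - mod + 1 ≤ mod * ((c₁ * (A * S)) / D) ∧ mod * ((c₁ * (A * S)) / D) ≤ κ₁ * S := by
  have hD0 : 0 < D := by rw [hD]; positivity
  have hA2 : 0 < A ^ 2 := by positivity
  set X := (c₁ * (A * S)) / D with hX
  have hup := mul_ediv_le_self' (c₁ * (A * S)) hD0
  have hlow := lt_mul_ediv_add (c₁ * (A * S)) hD0
  rw [← hX] at hup hlow
  rw [hc, hD] at hup hlow
  have e1 : A ^ 2 * mod * X = A ^ 2 * (mod * X) := by ring
  have e2 : A * κ₁ * (A * S) = A ^ 2 * (κ₁ * S) := by ring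
  constructor
  · have h2 : A ^ 2 * (κ₁ * S - mod) < A ^ 2 * (mod * X) := by nlinarith
    have := lt_of_mul_lt_mul_left h2 hA2.le
    linarith
  · exact le_of_mul_le_mul_left (by linarith) hA2

end Skelφ

end Summit.CriticalPhenomena.PercolationContinuityZ3.Theorems.Transplant
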